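import Literature.AnabelianGeometry.EtaleTheta.Discharge.Sec5Prop53ChainModelZ
import Literature.AnabelianGeometry.EtaleTheta.Discharge.Sec3Prop34CnstOfRlfRChainModel
import HarnessLib

/-!
# [EtTh] §5, Prop. 5.3 at the `ℤ`-chain model: the factorization homomorphism, the PRINCIPAL divisors `[(φ, −Δ²φ)]` (law (L)),
# and the INCIDENCE clause F3 of `DivisorSupportData'` proved from (L)

Mochizuki, *The étale theta function …*, Publ. RIMS **45** (2009), §5, proof of Prop. 5.3, p. 326 (PDF p. 100): "in this situation,
`n` is linearly equivalent to some element … of the form `n₁ + n₂ − a` … the multiplicities of `n₁, n₂` are equal to each other as well as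
to half the multiplicity of `a`"; §1 p. 240 (PDF p. 14) [cite: MochizukiEtTh2009, Prop 5.3 proof p.326 (PDF p.100)].  Cell abc-iut,
layer L2, ROWS #15d R287 (abc-iut-L2-lead gen 4); seat abc-iut-w6-d061 (gen 4).  Over `Sec5Prop53ChainModelZ.lean` (this seat:
`Φ(A_⊚) = ∏_{ℤ⊔ℤ} ℤ_{≥0}`, `chainPrimeDataZ`) and abc-iut-w6-d046's law (L) `D φ = (φ, −Δ²φ)` (`Sec3Prop34CnstOfRlfRChainModel.D`):
F2 `factorZ a 𝔭 := a(idx 𝔭)`, `genZ 𝔭 := e_{idx 𝔭}`, `ordGpOf'`/`suppOf'` on classes; F1 the integer coordinates `cZ`, the integer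
divisors `toGpZ d = [d⁺]/[d⁻]` and **`prinHom : φ ↦ [D φ]`** (principal divisors = divisors of the rational functions of the `Ÿ`-type chain);
**F3 `incidenceZ` PROVED**: `[b] − [a] ∼ m_n·C_j` with `b` cuspidal ⊥ the cuspidal primary `a` forces `φ = −m_n·δ_j`, hence `𝔞 = x_j`,
`a = 2m_n·x_j`, `[n] ∼ m_n(x_{j−1} + x_{j+1}) − [a]`.  Sequel: `Sec5Prop53ChainModelZSupport.lean` (the instance).
HONEST FRAMING: computations at a MODEL datum; nothing here bears on [IUTchIII] Cor. 3.12; no side taken; typed ≠ proved.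
-/

noncomputable section

namespace Literature.AnabelianGeometry.EtaleTheta.FrobenioidThetaDivisors.Prop53ChainZ

open CategoryTheory Literature.AlgebraicGeometry.Frobenioids ConstantMultiple ConstantMultiple.Cor512Toy Prop53Toy
  Prop53Chain Sec3Prop34CnstOfRlfRChainModel

/-! ### F2: the factorization homomorphism `a ↦ (a(idx 𝔭))_𝔭` and the generators `e_{idx 𝔭}` -/

/-- `ℤ_{≥0} ⊆ ℚ`, multiplicatively. [cite: MochizukiFrdI2008, Def. 2.4(i) p.47] -/
def castQ : Multiplicative ℕ →* Multiplicative ℚ := AddMonoidHom.toMultiplicative (Nat.castAddMonoidHom ℚ)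

/-- `castQ x = x` read in `ℚ`. [cite: MochizukiFrdI2008, Def. 2.4(i) p.47] -/
@[simp] theorem toAdd_castQ (x : Multiplicative ℕ) : Multiplicative.toAdd (castQ x) = ((Multiplicative.toAdd x : ℕ) : ℚ) := rfl

/-- `castQ` is injective. [cite: MochizukiFrdI2008, Def. 2.4(i) p.47] -/
theorem castQ_injective : Function.Injective castQ := fun x y h => by
  have h' := congrArg Multiplicative.toAdd h
  rw [toAdd_castQ, toAdd_castQ, Nat.cast_inj] at h'
  exact Multiplicative.toAdd.injective h'

/-- `castQ x = 1 ↔ x = 1`. [cite: MochizukiFrdI2008, Def. 2.4(i) p.47] -/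
theorem castQ_eq_one_iff (x : Multiplicative ℕ) : castQ x = 1 ↔ x = 1 := by
  rw [← map_one castQ]
  exact castQ_injective.eq_iff

/-- **F2: the factorization homomorphism** `Φ(A_⊚) → ∏_𝔭 ℚ`, `a ↦ (a(idx 𝔭))_𝔭` ([FrdI] Def. 2.4 (i)(c); [EtTh] Prop. 3.2 (i)).
[cite: MochizukiEtTh2009, Prop 3.2 (i) p.296 (PDF p.70)] -/
def factorZ : Φz →* (Primes Φz → Multiplicative ℚ) :=
  MonoidHom.pi fun 𝔭 => castQ.comp (Pi.evalMonoidHom (fun _ : Idx => Multiplicative ℕ) (idxZ 𝔭))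

/-- `factorZ a 𝔭 = a(idx 𝔭)`. [cite: MochizukiEtTh2009, Prop 3.2 (i) p.296 (PDF p.70)] -/
@[simp] theorem factorZ_apply (a : Φz) (𝔭 : Primes Φz) : factorZ a 𝔭 = castQ (a (idxZ 𝔭)) := rfl

/-- The prime log-divisor `gen 𝔭 := e_{idx 𝔭}`. [cite: MochizukiEtTh2009, Prop 5.3 p.325 (PDF p.99)] -/
def genZ (𝔭 : Primes Φz) : Φz := Pi.mulSingle (idxZ 𝔭) (Multiplicative.ofAdd 1)

/-- The order at `𝔭` on `Φ(A_⊚)^gp` evaluated on a class `[a]`. [cite: MochizukiEtTh2009, Prop 5.3 proof p.326 (PDF p.100)] -/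
theorem ordGpOf'_factorZ_of (𝔭 : Primes Φz) (a : Φz) :
    ordGpOf' factorZ 𝔭 (Algebra.GrothendieckGroup.of a) = castQ (a (idxZ 𝔭)) := by
  have h := Algebra.GrothendieckGroup.lift.symm_apply_apply (ordOf' factorZ 𝔭)
  rw [Algebra.GrothendieckGroup.lift_symm_apply] at h
  exact DFunLike.congr_fun h a

/-- `𝔭 ∈ supp[a]` iff `a(idx 𝔭) ≠ 0`. [cite: MochizukiEtTh2009, Prop 5.3 proof p.326 (PDF p.100)] -/
theorem mem_suppOf'_of_iff (𝔭 : Primes Φz) (a : Φz) : 𝔭 ∈ suppOf' factorZ (Algebra.GrothendieckGroup.of a) ↔ a (idxZ 𝔭) ≠ 1 := by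
  change ordGpOf' factorZ 𝔭 _ ≠ 1 ↔ _
  rw [ordGpOf'_factorZ_of, Ne, castQ_eq_one_iff]

/-- An element of the subset of a prime is a positive multiple of its generator, supported at its index only.
[cite: MochizukiFrdI2008, §0 p.12] -/
theorem eq_mulSingle_of_mem_carrier {𝔭 : Primes Φz} {a : Φz} (ha : a ∈ 𝔭.carrier) :
    a = Pi.mulSingle (idxZ 𝔭) (a (idxZ 𝔭)) ∧ a (idxZ 𝔭) ≠ 1 := by
  rw [mem_carrier_iff] at ha
  refine ⟨PiMonoprime.eq_mulSingle_of_dsupp_subset ha.le, ?_⟩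
  have h : idxZ 𝔭 ∈ dsupp a := by rw [ha]; rfl
  exact h

/-! ### F1: principal divisors `[(φ, −Δ²φ)]` — the coordinates `c_i : Φ^gp → ℤ` and the integer divisors `[d⁺]/[d⁻]` -/

/-- `ℤ_{≥0} ⊆ ℤ`, multiplicatively. [cite: MochizukiFrdI2008, Def. 2.4(i) p.47] -/
def castZ : Multiplicative ℕ →* Multiplicative ℤ := AddMonoidHom.toMultiplicative (Nat.castAddMonoidHom ℤ)

/-- The `i`-th integer coordinate `Φ(A_⊚)^gp → ℤ`. [cite: MochizukiFrdI2008, Def. 2.4(i) p.47] -/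
def cZ (i : Idx) : Algebra.GrothendieckGroup Φz →* Multiplicative ℤ :=
  Algebra.GrothendieckGroup.lift (castZ.comp (Pi.evalMonoidHom (fun _ : Idx => Multiplicative ℕ) i))

/-- `c_i [a] = a_i`. [cite: MochizukiFrdI2008, Def. 2.4(i) p.47] -/
theorem toAdd_cZ_of (i : Idx) (a : Φz) :
    Multiplicative.toAdd (cZ i (Algebra.GrothendieckGroup.of a)) = ((Multiplicative.toAdd (a i) : ℕ) : ℤ) := by
  have h := Algebra.GrothendieckGroup.lift.symm_apply_apply (castZ.comp (Pi.evalMonoidHom (fun _ : Idx => Multiplicative ℕ) i))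
  rw [Algebra.GrothendieckGroup.lift_symm_apply] at h
  exact congrArg Multiplicative.toAdd (DFunLike.congr_fun h a)

/-- **Joint injectivity of the integer coordinates on `Φ(A_⊚)^gp`** (`∏ ℤ_{≥0}` is cancellative).
[cite: MochizukiFrdI2008, Def. 2.4(i) p.47] -/
theorem eq_of_cZ_eq {x y : Algebra.GrothendieckGroup Φz} (hxy : ∀ i, cZ i x = cZ i y) : x = y := by
  obtain ⟨⟨a, b⟩, hx⟩ := (Localization.monoidOf (⊤ : Submonoid Φz)).surj x
  obtain ⟨⟨a', b'⟩, hy⟩ := (Localization.monoidOf (⊤ : Submonoid Φz)).surj y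
  have hx' : x = Algebra.GrothendieckGroup.of a / Algebra.GrothendieckGroup.of b.1 := eq_div_iff_mul_eq'.mpr hx
  have hy' : y = Algebra.GrothendieckGroup.of a' / Algebra.GrothendieckGroup.of b'.1 := eq_div_iff_mul_eq'.mpr hy
  rw [hx', hy', div_eq_div_iff_mul_eq_mul, ← map_mul, ← map_mul]
  congr 1
  funext i
  have h1 := congrArg Multiplicative.toAdd (hxy i)
  rw [hx', hy', map_div (cZ i), map_div (cZ i), toAdd_div, toAdd_div, toAdd_cZ_of, toAdd_cZ_of, toAdd_cZ_of,
    toAdd_cZ_of] at h1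
  apply Multiplicative.toAdd.injective
  rw [Pi.mul_apply, Pi.mul_apply, toAdd_mul, toAdd_mul]
  have h2 : ((Multiplicative.toAdd (a i) : ℕ) : ℤ) + Multiplicative.toAdd ((b' : Φz) i) =
      Multiplicative.toAdd (a' i) + Multiplicative.toAdd ((b : Φz) i) := by linarith
  exact_mod_cast h2

/-- The positive part of an integer vector, in `∏ ℤ_{≥0}`. [cite: MochizukiEtTh2009, Prop 3.2 (i) p.296 (PDF p.70)] -/
def posZ (d : Idx → ℤ) : Φz := fun i => Multiplicative.ofAdd (d i).toNat
/-- The negative part of an integer vector, in `∏ ℤ_{≥0}`. [cite: MochizukiEtTh2009, Prop 3.2 (i) p.296 (PDF p.70)] -/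
def negZ (d : Idx → ℤ) : Φz := fun i => Multiplicative.ofAdd (-d i).toNat

/-- The integer divisor `d ∈ ℤ^{ℤ⊔ℤ}` as the element `[d⁺]/[d⁻]` of `Φ(A_⊚)^gp`. [cite: MochizukiEtTh2009, Prop 3.2 (i) p.296 (PDF p.70)] -/
def toGpZ (d : Idx → ℤ) : Algebra.GrothendieckGroup Φz :=
  Algebra.GrothendieckGroup.of (posZ d) / Algebra.GrothendieckGroup.of (negZ d)

/-- `c_i ([d⁺]/[d⁻]) = d_i`. [cite: MochizukiEtTh2009, Prop 3.2 (i) p.296 (PDF p.70)] -/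
theorem toAdd_cZ_toGpZ (d : Idx → ℤ) (i : Idx) : Multiplicative.toAdd (cZ i (toGpZ d)) = d i := by
  rw [toGpZ, map_div (cZ i), toAdd_div, toAdd_cZ_of, toAdd_cZ_of, posZ, negZ, toAdd_ofAdd, toAdd_ofAdd]
  exact Int.toNat_sub_toNat_neg (d i)

/-- `toGpZ` is additive. [cite: MochizukiEtTh2009, Prop 3.2 (i) p.296 (PDF p.70)] -/
theorem toGpZ_add (d d' : Idx → ℤ) : toGpZ (d + d') = toGpZ d * toGpZ d' :=
  eq_of_cZ_eq fun i => Multiplicative.toAdd.injective (by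
    rw [map_mul (cZ i), toAdd_mul, toAdd_cZ_toGpZ, toAdd_cZ_toGpZ, toAdd_cZ_toGpZ, Pi.add_apply])

/-- `toGpZ 0 = 1`. [cite: MochizukiEtTh2009, Prop 3.2 (i) p.296 (PDF p.70)] -/
theorem toGpZ_zero : toGpZ (0 : Idx → ℤ) = 1 :=
  eq_of_cZ_eq fun i => Multiplicative.toAdd.injective (by rw [toAdd_cZ_toGpZ, map_one (cZ i), toAdd_one, Pi.zero_apply])

/-- **The principal divisors**: `φ ↦ [D φ] = [(φ, −Δ²φ)]`, a homomorphism `(ℤ^ℤ, +) → Φ(A_⊚)^gp` (law (L) of the `Ÿ`-type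
chain: the divisor of the rational function with component orders `φ`). [cite: MochizukiEtTh2009, §1 p.240 (PDF p.14)] -/
def prinHom : Multiplicative (ℤ → ℤ) →* Algebra.GrothendieckGroup Φz where
  toFun φ := toGpZ (D (Multiplicative.toAdd φ))
  map_one' := by rw [toAdd_one, D_zero, toGpZ_zero]
  map_mul' φ ψ := by rw [toAdd_mul, D_add, toGpZ_add]

/-- `c_i [D φ] = (D φ)_i`. [cite: MochizukiEtTh2009, §1 p.240 (PDF p.14)] -/
theorem toAdd_cZ_prinHom (φ : ℤ → ℤ) (i : Idx) :
    Multiplicative.toAdd (cZ i (prinHom (Multiplicative.ofAdd φ))) = D φ i :=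
  toAdd_cZ_toGpZ _ i

/-- `prinHom` unfolded. [cite: MochizukiEtTh2009, §1 p.240 (PDF p.14)] -/
theorem prinHom_apply (φm : Multiplicative (ℤ → ℤ)) : prinHom φm = toGpZ (D (Multiplicative.toAdd φm)) := rfl

/-! ### F3: the incidence clause from the law (L) -/

/-- **F3 (incidence) at the `ℤ`-chain model, from the law (L).**  If `a` is primary at the cusp `𝔞`, `n = m_n·C_j` primary at the
component `𝔫 = C_j`, `b` cuspidal and coprime to `a`, and `[b] − [a] ∼ [n]` modulo the principal divisors `[(φ, −Δ²φ)]`, then the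
rational function is forced (`φ = −m_n·δ_j`), so `𝔞 = x_j`, `a = 2m_n·x_j`, and `[n] ∼ m_n(x_{j−1} + x_{j+1}) − [a]`.
[cite: MochizukiEtTh2009, Prop 5.3 proof p.326 (PDF p.100)] -/
theorem incidenceZ (𝔞 𝔫 : Primes Φz) (h𝔫 : ¬ chainPrimeDataZ.IsCuspidal 𝔫) (a b n : Φz)
    (h𝔞 : chainPrimeDataZ.IsCuspidal 𝔞) (ha : a ∈ 𝔞.carrier) (hn : n ∈ 𝔫.carrier)
    (hb : IsCuspidalGpOf' chainPrimeDataZ factorZ (Algebra.GrothendieckGroup.of b))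
    (hcop : CoprimeOf' factorZ (Algebra.GrothendieckGroup.of a) (Algebra.GrothendieckGroup.of b))
    (hlin : LinEquivOf prinHom.range (Algebra.GrothendieckGroup.of b * (Algebra.GrothendieckGroup.of a)⁻¹)
      (Algebra.GrothendieckGroup.of n)) :
    ∃ (𝔠₁ 𝔠₂ : Primes Φz) (h₁ : chainPrimeDataZ.IsCuspidal 𝔠₁) (h₂ : chainPrimeDataZ.IsCuspidal 𝔠₂) (m : ℕ),
      chainPrimeDataZ.ncspEquivZ (chainPrimeDataZ.cspToNcsp ⟨𝔠₁, h₁⟩) = chainPrimeDataZ.ncspEquivZ ⟨𝔫, h𝔫⟩ - 1 ∧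
      chainPrimeDataZ.ncspEquivZ (chainPrimeDataZ.cspToNcsp ⟨𝔠₂, h₂⟩) = chainPrimeDataZ.ncspEquivZ ⟨𝔫, h𝔫⟩ + 1 ∧
      ordOf' factorZ 𝔞 a = Multiplicative.ofAdd (2 * (m : ℚ)) ∧
      LinEquivOf prinHom.range (Algebra.GrothendieckGroup.of n)
        (Algebra.GrothendieckGroup.of (genZ 𝔠₁ ^ m * genZ 𝔠₂ ^ m) * (Algebra.GrothendieckGroup.of a)⁻¹) := by
  classical
  -- indices and closed forms of `a`, `n`
  obtain ⟨j, hj⟩ := idxZ_eq_inl_of_not_isCuspZ h𝔫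
  obtain ⟨k, hk⟩ := h𝔞
  obtain ⟨ha1, ha2⟩ := eq_mulSingle_of_mem_carrier ha
  obtain ⟨hn1, hn2⟩ := eq_mulSingle_of_mem_carrier hn
  rw [hk] at ha1 ha2
  rw [hj] at hn1 hn2
  set ma : ℕ := Multiplicative.toAdd (a (Sum.inr k)) with hma
  set mn : ℕ := Multiplicative.toAdd (n (Sum.inl j)) with hmn
  have hma0 : 0 < ma := Nat.pos_of_ne_zero fun h => ha2 (Multiplicative.toAdd.injective (by rw [← hma, h]; rfl))
  have haval : ∀ i : Idx, ((Multiplicative.toAdd (a i) : ℕ) : ℤ) = if i = Sum.inr k then (ma : ℤ) else 0 := by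
    intro i
    rw [ha1, Pi.mulSingle_apply]
    split_ifs <;> rfl
  have hnval : ∀ i : Idx, ((Multiplicative.toAdd (n i) : ℕ) : ℤ) = if i = Sum.inl j then (mn : ℤ) else 0 := by
    intro i
    rw [hn1, Pi.mulSingle_apply]
    split_ifs <;> rfl
  -- `b` vanishes at the components (cuspidal) and at the cusp `x_k` of `a` (coprime)
  have hb0 : ∀ i' : ℤ, b (Sum.inl i') = 1 := by
    intro i'
    by_contra hne
    exact not_isCuspZ_PZ_inl i' (hb _ ((mem_suppOf'_of_iff _ _).mpr (by rwa [idxZ_PZ])))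
  have hbk : b (Sum.inr k) = 1 := by
    by_contra hne
    have h1 : 𝔞 ∈ suppOf' factorZ (Algebra.GrothendieckGroup.of a) := (mem_suppOf'_of_iff _ _).mpr (by rwa [hk])
    have h2 : 𝔞 ∈ suppOf' factorZ (Algebra.GrothendieckGroup.of b) := (mem_suppOf'_of_iff _ _).mpr (by rwa [hk])
    exact Set.disjoint_left.mp hcop h1 h2
  -- the rational function `φ` with `[b] − [a] − [n] = [D φ]`, read in coordinates
  have hlin' : Algebra.GrothendieckGroup.of b * (Algebra.GrothendieckGroup.of a)⁻¹ * (Algebra.GrothendieckGroup.of n)⁻¹ ∈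
      prinHom.range := hlin
  obtain ⟨φm, hφ⟩ := hlin'
  set φ : ℤ → ℤ := Multiplicative.toAdd φm with hφdef
  have hcoord : ∀ i : Idx, D φ i =
      ((Multiplicative.toAdd (b i) : ℕ) : ℤ) - ((Multiplicative.toAdd (a i) : ℕ) : ℤ) - ((Multiplicative.toAdd (n i) : ℕ) : ℤ) := by
    intro i
    have h := congrArg (fun x => Multiplicative.toAdd (cZ i x)) hφ
    simp only [prinHom_apply, toAdd_cZ_toGpZ] at h
    rw [map_mul (cZ i), map_mul (cZ i), map_inv (cZ i), map_inv (cZ i), toAdd_mul, toAdd_mul, toAdd_inv, toAdd_inv,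
      toAdd_cZ_of, toAdd_cZ_of, toAdd_cZ_of] at h
    rw [h]
    ring
  -- components: `φ i' = −n(C_{i'})`
  have hφ : ∀ i' : ℤ, φ i' = if i' = j then -(mn : ℤ) else 0 := by
    intro i'
    have h := hcoord (Sum.inl i')
    rw [D_inl, hb0, haval, hnval] at h
    simp only [toAdd_one, Nat.cast_zero, reduceCtorEq, if_false, Sum.inl.injEq] at h
    rw [h]
    split_ifs <;> ring
  have hlap : ∀ i' : ℤ, lap φ i' = (if i' + 1 = j then -(mn : ℤ) else 0) - 2 * (if i' = j then -(mn : ℤ) else 0) +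
      (if i' - 1 = j then -(mn : ℤ) else 0) := by
    intro i'
    rw [lap, hφ, hφ, hφ]
  -- the cusp `x_k` of `a`: `−Δ²φ(k) = −a_k`, forcing `k = j` and `a_k = 2 m_n`
  have hk_eq : k = j ∧ (ma : ℤ) = 2 * mn := by
    have h := hcoord (Sum.inr k)
    rw [D_inr, hbk, haval, hnval, hlap] at h
    simp only [toAdd_one, Nat.cast_zero, if_true, reduceCtorEq, if_false] at h
    by_cases hkj : k = j
    · subst hkj
      refine ⟨rfl, ?_⟩
      have h1 : ¬ (k + 1 = k) := by omega
      have h2 : ¬ (k - 1 = k) := by omega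
      simp only [h1, h2, if_false, if_true] at h
      linarith
    · exfalso
      simp only [hkj, if_false] at h
      have : (0 : ℤ) < ma := by exact_mod_cast hma0
      split_ifs at h <;> linarith
  obtain ⟨rfl, hma2⟩ := hk_eq
  -- the neighbouring cusps: `b(x_{j±1}) = m_n`
  have hbval : ∀ i' : ℤ, i' ≠ k → ((Multiplicative.toAdd (b (Sum.inr i')) : ℕ) : ℤ) = -lap φ i' := by
    intro i' hi'
    have h := hcoord (Sum.inr i')
    rw [D_inr, haval, hnval] at h
    have h1 : ¬ (Sum.inr i' : Idx) = Sum.inr k := fun e => hi' (Sum.inr_injective e)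
    simp only [h1, if_false, reduceCtorEq] at h
    linarith
  -- the witnesses
  refine ⟨PZ (Sum.inr (k - 1)), PZ (Sum.inr (k + 1)), isCuspZ_PZ_inr _, isCuspZ_PZ_inr _, mn, ?_, ?_, ?_, ?_⟩
  · show labelZ (PZ (Sum.inl (labelZ (PZ (Sum.inr (k - 1)))))) = labelZ 𝔫 - 1
    rw [labelZ_PZ_inr, labelZ_PZ_inl]
    simp [labelZ, hj]
  · show labelZ (PZ (Sum.inl (labelZ (PZ (Sum.inr (k + 1)))))) = labelZ 𝔫 + 1
    rw [labelZ_PZ_inr, labelZ_PZ_inl]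
    simp [labelZ, hj]
  · show factorZ a 𝔞 = _
    rw [factorZ_apply, hk]
    apply Multiplicative.toAdd.injective
    rw [toAdd_castQ, toAdd_ofAdd, ← hma]
    exact_mod_cast hma2
  · -- `[n] ∼ m_n (x_{k−1} + x_{k+1}) − [a]` via the rational function `U_k^{m_n}` (`φ' = −φ`)
    show Algebra.GrothendieckGroup.of n *
        (Algebra.GrothendieckGroup.of (genZ (PZ (Sum.inr (k - 1))) ^ mn * genZ (PZ (Sum.inr (k + 1))) ^ mn) *
          (Algebra.GrothendieckGroup.of a)⁻¹)⁻¹ ∈ prinHom.range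
    -- coordinates of `m_n (x_{k−1} + x_{k+1})`
    have hG : ∀ i : Idx,
        ((Multiplicative.toAdd ((genZ (PZ (Sum.inr (k - 1))) ^ mn * genZ (PZ (Sum.inr (k + 1))) ^ mn) i) : ℕ) : ℤ) =
          (if i = Sum.inr (k - 1) then (mn : ℤ) else 0) + (if i = Sum.inr (k + 1) then (mn : ℤ) else 0) := by
      intro i
      rw [Pi.mul_apply, Pi.pow_apply, Pi.pow_apply, genZ, genZ, idxZ_PZ, idxZ_PZ, toAdd_mul, toAdd_pow, toAdd_pow,
        Pi.mulSingle_apply, Pi.mulSingle_apply]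
      split_ifs <;> simp
    have hD : ∀ i' : ℤ, D (-φ) (Sum.inr i') = lap φ i' := by
      intro i'
      rw [D_inr, lap, lap, Pi.neg_apply, Pi.neg_apply, Pi.neg_apply]
      ring
    -- the coordinate identity `D(−φ) = [n] + [a] − m_n (x_{k−1} + x_{k+1})`
    have key : ∀ i : Idx, D (-φ) i = ((Multiplicative.toAdd (n i) : ℕ) : ℤ) + ((Multiplicative.toAdd (a i) : ℕ) : ℤ) -
        ((Multiplicative.toAdd ((genZ (PZ (Sum.inr (k - 1))) ^ mn * genZ (PZ (Sum.inr (k + 1))) ^ mn) i) : ℕ) : ℤ) := by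
      intro i
      rw [haval, hnval, hG]
      rcases i with i' | i'
      · rw [D_inl, Pi.neg_apply, hφ]
        simp only [Sum.inl.injEq, reduceCtorEq, if_false]
        split_ifs <;> ring
      · rw [hD, hlap]
        simp only [Sum.inr.injEq, reduceCtorEq, if_false]
        split_ifs <;> omega
    refine ⟨Multiplicative.ofAdd (-φ), eq_of_cZ_eq fun i => Multiplicative.toAdd.injective ?_⟩
    rw [prinHom_apply, toAdd_ofAdd, toAdd_cZ_toGpZ, map_mul (cZ i), map_inv (cZ i), map_mul (cZ i), map_inv (cZ i),
      toAdd_mul, toAdd_inv, toAdd_mul, toAdd_inv, toAdd_cZ_of, toAdd_cZ_of, toAdd_cZ_of, key]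
    ring

end Literature.AnabelianGeometry.EtaleTheta.FrobenioidThetaDivisors.Prop53ChainZ

end
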